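import Summits.RiemannHypothesis.RiemannHypothesis.Theorems.WeilFormatCDataO106FrontDataW
import Summits.RiemannHypothesis.RiemannHypothesis.Theorems.WeilFormatCDataA1RungCB
import Summits.RiemannHypothesis.RiemannHypothesis.Theorems.S2FormatCE0
import Literature.NumberTheory.LFunctions.YoshidaWindowGramTailMSSines
import Literature.NumberTheory.LFunctions.YoshidaWindowGramMiddleJBox
import Literature.NumberTheory.LFunctions.YoshidaWindowGramTailJFactoredScaled
import Literature.NumberTheory.LFunctions.YoshidaWindowGramTailMSFactored
import Literature.NumberTheory.LFunctions.YoshidaWindowGramTailJDiagTight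
import Summits.RiemannHypothesis.RiemannHypothesis.Theorems.FormatCPsdBands
import Summits.RiemannHypothesis.RiemannHypothesis.Theorems.WeilFormatCDiagShift
import Summits.RiemannHypothesis.RiemannHypothesis.Theorems.FormatCPsdSymmBands
import HarnessLib
import Summits.RiemannHypothesis.RiemannHypothesis.Theorems.WeilFormatCDataO106Tables1
import Summits.RiemannHypothesis.RiemannHypothesis.Theorems.WeilFormatCDataO106Tables2
import Summits.RiemannHypothesis.RiemannHypothesis.Theorems.WeilFormatCDataO106Tables3
import Summits.RiemannHypothesis.RiemannHypothesis.Theorems.WeilFormatCDataO106Tables4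
import Summits.RiemannHypothesis.RiemannHypothesis.Theorems.WeilFormatCDataO106Tables5
import Summits.RiemannHypothesis.RiemannHypothesis.Theorems.WeilFormatCDataO106Tables
import Summits.RiemannHypothesis.RiemannHypothesis.Theorems.WeilFormatCDataO106ColTables1
import Summits.RiemannHypothesis.RiemannHypothesis.Theorems.WeilFormatCDataO106ColTables2
import Summits.RiemannHypothesis.RiemannHypothesis.Theorems.WeilFormatCDataO106ColTables3
import Summits.RiemannHypothesis.RiemannHypothesis.Theorems.WeilFormatCDataO106ColTables4
import Summits.RiemannHypothesis.RiemannHypothesis.Theorems.WeilFormatCDataO106ColTables5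
import Summits.RiemannHypothesis.RiemannHypothesis.Theorems.WeilFormatCDataO106ColTables6
import Summits.RiemannHypothesis.RiemannHypothesis.Theorems.WeilFormatCDataO106ColTables7
import Summits.RiemannHypothesis.RiemannHypothesis.Theorems.WeilFormatCDataO106ColTables8
import Summits.RiemannHypothesis.RiemannHypothesis.Theorems.WeilFormatCDataO106ColTables9
import Summits.RiemannHypothesis.RiemannHypothesis.Theorems.WeilFormatCDataO106ColTables10
import Summits.RiemannHypothesis.RiemannHypothesis.Theorems.WeilFormatCDataO106ColTables11
import Summits.RiemannHypothesis.RiemannHypothesis.Theorems.WeilFormatCDataO106ColTables12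
import Summits.RiemannHypothesis.RiemannHypothesis.Theorems.WeilFormatCDataO106ColTables13
import Summits.RiemannHypothesis.RiemannHypothesis.Theorems.WeilFormatCDataO106ColTables14
import Summits.RiemannHypothesis.RiemannHypothesis.Theorems.WeilFormatCDataO106ColTables15
import Summits.RiemannHypothesis.RiemannHypothesis.Theorems.WeilFormatCDataO106ColTables16
import Summits.RiemannHypothesis.RiemannHypothesis.Theorems.WeilFormatCDataO106ColTables17
import Summits.RiemannHypothesis.RiemannHypothesis.Theorems.WeilFormatCDataO106ColTables18
import Summits.RiemannHypothesis.RiemannHypothesis.Theorems.WeilFormatCDataO106ColTables19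
import Summits.RiemannHypothesis.RiemannHypothesis.Theorems.WeilFormatCDataO106ColTables20
import Summits.RiemannHypothesis.RiemannHypothesis.Theorems.WeilFormatCDataO106ColTables21
import Summits.RiemannHypothesis.RiemannHypothesis.Theorems.WeilFormatCDataO106ColTables22
import Summits.RiemannHypothesis.RiemannHypothesis.Theorems.WeilFormatCDataO106ColTables23
import Summits.RiemannHypothesis.RiemannHypothesis.Theorems.WeilFormatCDataO106ColTables24
import Summits.RiemannHypothesis.RiemannHypothesis.Theorems.WeilFormatCDataO106ColTables25
import Summits.RiemannHypothesis.RiemannHypothesis.Theorems.WeilFormatCDataO106ColTables26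
import Summits.RiemannHypothesis.RiemannHypothesis.Theorems.WeilFormatCDataO106ColTables27
import Summits.RiemannHypothesis.RiemannHypothesis.Theorems.WeilFormatCDataO106ColTables28
import Summits.RiemannHypothesis.RiemannHypothesis.Theorems.WeilFormatCDataO106ColTables29
import Summits.RiemannHypothesis.RiemannHypothesis.Theorems.WeilFormatCDataO106ColTables30
import Summits.RiemannHypothesis.RiemannHypothesis.Theorems.WeilFormatCDataO106ColTables31
import Summits.RiemannHypothesis.RiemannHypothesis.Theorems.WeilFormatCDataO106ColTables32
import Summits.RiemannHypothesis.RiemannHypothesis.Theorems.WeilFormatCDataO106ColTables33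
import Summits.RiemannHypothesis.RiemannHypothesis.Theorems.WeilFormatCDataO106ColTables34
import Summits.RiemannHypothesis.RiemannHypothesis.Theorems.WeilFormatCDataO106ColTables35
import Summits.RiemannHypothesis.RiemannHypothesis.Theorems.WeilFormatCDataO106ColTables
import Summits.RiemannHypothesis.RiemannHypothesis.Theorems.WeilFormatCDataO106CBOddXP1
import Summits.RiemannHypothesis.RiemannHypothesis.Theorems.WeilFormatCDataO106CBOddXP2
import Summits.RiemannHypothesis.RiemannHypothesis.Theorems.WeilFormatCDataO106CBOddXP3
import Summits.RiemannHypothesis.RiemannHypothesis.Theorems.WeilFormatCDataO106CBOddXP4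
import Summits.RiemannHypothesis.RiemannHypothesis.Theorems.WeilFormatCDataO106CBOddXP5
import Summits.RiemannHypothesis.RiemannHypothesis.Theorems.WeilFormatCDataO106CBOddXP6
import Summits.RiemannHypothesis.RiemannHypothesis.Theorems.WeilFormatCDataO106CBOddXP7
import Summits.RiemannHypothesis.RiemannHypothesis.Theorems.WeilFormatCDataO106CBOddXP8
import Summits.RiemannHypothesis.RiemannHypothesis.Theorems.WeilFormatCDataO106CBOddXP9
import Summits.RiemannHypothesis.RiemannHypothesis.Theorems.WeilFormatCDataO106CBOddXP10
import Summits.RiemannHypothesis.RiemannHypothesis.Theorems.WeilFormatCDataO106CBOddXP11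
import Summits.RiemannHypothesis.RiemannHypothesis.Theorems.WeilFormatCDataO106CBOddXP12
import Summits.RiemannHypothesis.RiemannHypothesis.Theorems.WeilFormatCDataO106CBOddXP13
import Summits.RiemannHypothesis.RiemannHypothesis.Theorems.WeilFormatCDataO106CBOddXP14
import Summits.RiemannHypothesis.RiemannHypothesis.Theorems.WeilFormatCDataO106CBOddXP15
import Summits.RiemannHypothesis.RiemannHypothesis.Theorems.WeilFormatCDataO106CBOddXP16
import Summits.RiemannHypothesis.RiemannHypothesis.Theorems.WeilFormatCDataO106CBOddXP17
import Summits.RiemannHypothesis.RiemannHypothesis.Theorems.WeilFormatCDataO106CBOddXP18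
import Summits.RiemannHypothesis.RiemannHypothesis.Theorems.WeilFormatCDataO106CBOddXP19
import Summits.RiemannHypothesis.RiemannHypothesis.Theorems.WeilFormatCDataO106CBOddXP20
import Summits.RiemannHypothesis.RiemannHypothesis.Theorems.WeilFormatCDataO106CBOddXP21
import Summits.RiemannHypothesis.RiemannHypothesis.Theorems.WeilFormatCDataO106CBOddXP22
import Summits.RiemannHypothesis.RiemannHypothesis.Theorems.WeilFormatCDataO106CBOddXP23
import Summits.RiemannHypothesis.RiemannHypothesis.Theorems.WeilFormatCDataO106CBOddXP24
import Summits.RiemannHypothesis.RiemannHypothesis.Theorems.WeilFormatCDataO106CBOddXP25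
import Summits.RiemannHypothesis.RiemannHypothesis.Theorems.WeilFormatCDataO106CBOddDSP1
import Summits.RiemannHypothesis.RiemannHypothesis.Theorems.WeilFormatCDataO106CBOddDSP2
import Summits.RiemannHypothesis.RiemannHypothesis.Theorems.WeilFormatCDataO106CBOddDSP3
import Summits.RiemannHypothesis.RiemannHypothesis.Theorems.WeilFormatCDataO106CBOddDSP4
import Summits.RiemannHypothesis.RiemannHypothesis.Theorems.WeilFormatCDataO106CBOddDSP5
import Summits.RiemannHypothesis.RiemannHypothesis.Theorems.WeilFormatCDataO106CBOddDSP6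
import Summits.RiemannHypothesis.RiemannHypothesis.Theorems.WeilFormatCDataO106CBOddDSP7
import Summits.RiemannHypothesis.RiemannHypothesis.Theorems.WeilFormatCDataO106CBOddDSP8
import Summits.RiemannHypothesis.RiemannHypothesis.Theorems.WeilFormatCDataO106CBOddDSP9
import Summits.RiemannHypothesis.RiemannHypothesis.Theorems.WeilFormatCDataO106CBOddDSP10
import Summits.RiemannHypothesis.RiemannHypothesis.Theorems.WeilFormatCDataO106CBOddDSP11
import Summits.RiemannHypothesis.RiemannHypothesis.Theorems.WeilFormatCDataO106CBOddDSP12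
import Summits.RiemannHypothesis.RiemannHypothesis.Theorems.WeilFormatCDataO106CBOddDSP13
import Summits.RiemannHypothesis.RiemannHypothesis.Theorems.WeilFormatCDataO106CBOddDSP14
import Summits.RiemannHypothesis.RiemannHypothesis.Theorems.WeilFormatCDataO106CBOddDSP15
import Summits.RiemannHypothesis.RiemannHypothesis.Theorems.WeilFormatCDataO106CBOddDSP16
import Summits.RiemannHypothesis.RiemannHypothesis.Theorems.WeilFormatCDataO106CBOddDSP17
import Summits.RiemannHypothesis.RiemannHypothesis.Theorems.WeilFormatCDataO106CBOddDSP18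
import Summits.RiemannHypothesis.RiemannHypothesis.Theorems.WeilFormatCDataO106CBOddDSP19
import Summits.RiemannHypothesis.RiemannHypothesis.Theorems.WeilFormatCDataO106CBOddDSP20
import Summits.RiemannHypothesis.RiemannHypothesis.Theorems.WeilFormatCDataO106CBOddDSP21
import Summits.RiemannHypothesis.RiemannHypothesis.Theorems.WeilFormatCDataO106CBOddDSP22
import Summits.RiemannHypothesis.RiemannHypothesis.Theorems.WeilFormatCDataO106CBOddDSP23
import Summits.RiemannHypothesis.RiemannHypothesis.Theorems.WeilFormatCDataO106CBOddDSP24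
import Summits.RiemannHypothesis.RiemannHypothesis.Theorems.WeilFormatCDataO106CBOddDSP25
import Summits.RiemannHypothesis.RiemannHypothesis.Theorems.WeilFormatCDataO106CBOddDSP26
import Summits.RiemannHypothesis.RiemannHypothesis.Theorems.WeilFormatCDataO106CBOddDSP27
import Summits.RiemannHypothesis.RiemannHypothesis.Theorems.WeilFormatCDataO106CBOddDSP28
import Summits.RiemannHypothesis.RiemannHypothesis.Theorems.WeilFormatCDataO106CBOddDSP29
import Summits.RiemannHypothesis.RiemannHypothesis.Theorems.WeilFormatCDataO106CBOddDSP30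
import Summits.RiemannHypothesis.RiemannHypothesis.Theorems.WeilFormatCDataO106CBOddLP1
import Summits.RiemannHypothesis.RiemannHypothesis.Theorems.WeilFormatCDataO106CBOddLP2
import Summits.RiemannHypothesis.RiemannHypothesis.Theorems.WeilFormatCDataO106CBOddLP3
import Summits.RiemannHypothesis.RiemannHypothesis.Theorems.WeilFormatCDataO106CBOddLP4
import Summits.RiemannHypothesis.RiemannHypothesis.Theorems.WeilFormatCDataO106CBOddLP5
import Summits.RiemannHypothesis.RiemannHypothesis.Theorems.WeilFormatCDataO106CBOddLP6
import Summits.RiemannHypothesis.RiemannHypothesis.Theorems.WeilFormatCDataO106CBOddLP7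
import Summits.RiemannHypothesis.RiemannHypothesis.Theorems.WeilFormatCDataO106CBOddLP8
import Summits.RiemannHypothesis.RiemannHypothesis.Theorems.WeilFormatCDataO106CBOddLP9
import Summits.RiemannHypothesis.RiemannHypothesis.Theorems.WeilFormatCDataO106CBOddLP10
import Summits.RiemannHypothesis.RiemannHypothesis.Theorems.WeilFormatCDataO106CBOddLP11
import Summits.RiemannHypothesis.RiemannHypothesis.Theorems.WeilFormatCDataO106CBOddLP12
import Summits.RiemannHypothesis.RiemannHypothesis.Theorems.WeilFormatCDataO106CBOddPhiP1
import Summits.RiemannHypothesis.RiemannHypothesis.Theorems.WeilFormatCDataO106CBOddPsiP1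
import Summits.RiemannHypothesis.RiemannHypothesis.Theorems.WeilFormatCDataO106CBOddRD
import Summits.RiemannHypothesis.RiemannHypothesis.Theorems.WeilFormatCDataO106FrontData
import Summits.RiemannHypothesis.RiemannHypothesis.Theorems.WeilFormatCDataO106ColSlice26
import Summits.RiemannHypothesis.RiemannHypothesis.Theorems.WeilFormatCDataO106ColSlice27
import Summits.RiemannHypothesis.RiemannHypothesis.Theorems.WeilFormatCDataO106ColSlice28
import Summits.RiemannHypothesis.RiemannHypothesis.Theorems.WeilFormatCDataO106Front
import Summits.RiemannHypothesis.RiemannHypothesis.Theorems.WeilFormatCDataO106FrontW1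
import Summits.RiemannHypothesis.RiemannHypothesis.Theorems.WeilFormatCDataO106FrontW2
import Summits.RiemannHypothesis.RiemannHypothesis.Theorems.WeilFormatCDataO106MidEntAA
import Summits.RiemannHypothesis.RiemannHypothesis.Theorems.WeilFormatCDataO106MidEntAB
import Summits.RiemannHypothesis.RiemannHypothesis.Theorems.WeilFormatCDataO106MidEntBA
import Summits.RiemannHypothesis.RiemannHypothesis.Theorems.WeilFormatCDataO106MidBB
import Summits.RiemannHypothesis.RiemannHypothesis.Theorems.WeilFormatCDataO106CBOddCols0
import Summits.RiemannHypothesis.RiemannHypothesis.Theorems.WeilFormatCDataO106CBOddCols1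
import Summits.RiemannHypothesis.RiemannHypothesis.Theorems.WeilFormatCDataO106OddAsmA
import Summits.RiemannHypothesis.RiemannHypothesis.Theorems.WeilFormatCDataO106OddAsmF
import Summits.RiemannHypothesis.RiemannHypothesis.Theorems.WeilFormatCDataO106OddAsmH

/-!
# Format C kernel rung `O106` (a = 53/50, column-band layout): ASSEMBLY of the flat layout, part I of 26 (ladders of ColSlice28 (cont.), Front, Mid, CBOddCols0, CBOddCols1; split of the 4013-line assembly at block boundaries by prover B g19 for the 400-line cap; blocks byte-identical): every propositional ladder of the kernel files (table/column validity, front door, sines, middle moments, column data, tail factors, Schur rows, (P) + diagonal shift), byte-identical statements and proofs, original order (A g22 restage_flat.py; weil-2 KERNEL-CHAIN-RULES #1)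

Window `a = 53/50`; prime powers in the window: 2, 3, 2^2, 5, 7, 2^3; prime constant A = 2358/1000 (`WeilFormatC.primeCoeff_form_ge_cells_1098`); evaluator parameters S = 2^320, Kpi 160, Kser 190, kred 8, Kexp 55, J 150; full table modes < 321; light column table modes < 2051; units 2^-310 (Schur entries), 2^-154 (column digits, width 157), 2^-148 (tail-factor digits, width 151), 2^-64 (reciprocal weights), 2^-40 (tail base); order-J tail J = 4, θ = 1/2048, η = 1/10 | 4/1.
Design row: sr-gb-rung-b B g21 hp odd λ-run (parity CELL 15 L-side, the first window PAST the (log 8)/2 resonance): a = 53/50, SIX prime powers 2,3,4,5,7,8 (kmax 8), A = 2358/1000 (WeilFormatC.primeCoeff_form_ge_cells_1098), μ = 2^-103, odd 320/640/2048, kit precision S 2^320 / c 310 / Kpi 160 / Kser 190 / Kexp 55 / J 150; pairs with A g24 trialUpper1035sharp = 21e-33; see HOME(B)/CELL14-LSIDE-B-g21.md §4. Generated by sr-gb-rung-a prover A g22 with rh-explicit-weil-2 gen7's generator extended for the odd λ-run (--sector odd --mu-log2; HOME(A)/code-g22/gen7/gramgen7.py sha16 b21c15hp1060001) from `#eval`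 of the tree's `Encl` functions; every datum is re-verified by the kernel in the theorem files (`decide +kernel`). Helper data of the rh-explicit Weil-positivity programme (format C, K-CELL-2), RH-free. [cite: Yoshida1992HermitianForms, §5 (5.15)-(5.16) p. 301; §7 pp. 305–312]
-/

set_option linter.dupNamespace false
set_option exponentiation.threshold 1024
set_option maxRecDepth 200000

-- ===== from WeilFormatCDataO106ColSlice28 (continued) =====
namespace Summit.RiemannHypothesis.RiemannHypothesis.Theorems.WeilFormatCData.O106
open Literature.NumberTheory.LFunctions Literature.NumberTheory.LFunctions.Yoshida1992 Encl Literature.Analysis.ValidatedNumerics.NumericsMP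

/-- the light column table is valid on `[320, 2051)`. -/
theorem ctab_valid : TabColValid (2 ^ 320) O106.a O106.ks 320 2051 O106.ctab := by
  have h1910 : TabColValid (2 ^ 320) a ks 320 (1900 + 10) ctab := ctab_valid_p2
  have h1920 : TabColValid (2 ^ 320) a ks 320 (1910 + 10) ctab :=
    h1910.extend fun m hm hmk ↦ colValid_of_checkTableCol (prm := prm) (by norm_num [prm]) a_pos consts_valid tC1910 hm hmk
  have h1930 : TabColValid (2 ^ 320) a ks 320 (1920 + 10) ctab :=
    h1920.extend fun m hm hmk ↦ colValid_of_checkTableCol (prm := prm) (by norm_num [prm]) a_pos consts_valid tC1920 hm hmk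
  have h1940 : TabColValid (2 ^ 320) a ks 320 (1930 + 10) ctab :=
    h1930.extend fun m hm hmk ↦ colValid_of_checkTableCol (prm := prm) (by norm_num [prm]) a_pos consts_valid tC1930 hm hmk
  have h1950 : TabColValid (2 ^ 320) a ks 320 (1940 + 10) ctab :=
    h1940.extend fun m hm hmk ↦ colValid_of_checkTableCol (prm := prm) (by norm_num [prm]) a_pos consts_valid tC1940 hm hmk
  have h1960 : TabColValid (2 ^ 320) a ks 320 (1950 + 10) ctab :=
    h1950.extend fun m hm hmk ↦ colValid_of_checkTableCol (prm := prm) (by norm_num [prm]) a_pos consts_valid tC1950 hm hmk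
  have h1970 : TabColValid (2 ^ 320) a ks 320 (1960 + 10) ctab :=
    h1960.extend fun m hm hmk ↦ colValid_of_checkTableCol (prm := prm) (by norm_num [prm]) a_pos consts_valid tC1960 hm hmk
  have h1980 : TabColValid (2 ^ 320) a ks 320 (1970 + 10) ctab :=
    h1970.extend fun m hm hmk ↦ colValid_of_checkTableCol (prm := prm) (by norm_num [prm]) a_pos consts_valid tC1970 hm hmk
  have h1990 : TabColValid (2 ^ 320) a ks 320 (1980 + 10) ctab :=
    h1980.extend fun m hm hmk ↦ colValid_of_checkTableCol (prm := prm) (by norm_num [prm]) a_pos consts_valid tC1980 hm hmk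
  have h2000 : TabColValid (2 ^ 320) a ks 320 (1990 + 10) ctab :=
    h1990.extend fun m hm hmk ↦ colValid_of_checkTableCol (prm := prm) (by norm_num [prm]) a_pos consts_valid tC1990 hm hmk
  have h2010 : TabColValid (2 ^ 320) a ks 320 (2000 + 10) ctab :=
    h2000.extend fun m hm hmk ↦ colValid_of_checkTableCol (prm := prm) (by norm_num [prm]) a_pos consts_valid tC2000 hm hmk
  have h2020 : TabColValid (2 ^ 320) a ks 320 (2010 + 10) ctab :=
    h2010.extend fun m hm hmk ↦ colValid_of_checkTableCol (prm := prm) (by norm_num [prm]) a_pos consts_valid tC2010 hm hmk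
  have h2030 : TabColValid (2 ^ 320) a ks 320 (2020 + 10) ctab :=
    h2020.extend fun m hm hmk ↦ colValid_of_checkTableCol (prm := prm) (by norm_num [prm]) a_pos consts_valid tC2020 hm hmk
  have h2040 : TabColValid (2 ^ 320) a ks 320 (2030 + 10) ctab :=
    h2030.extend fun m hm hmk ↦ colValid_of_checkTableCol (prm := prm) (by norm_num [prm]) a_pos consts_valid tC2030 hm hmk
  have h2050 : TabColValid (2 ^ 320) a ks 320 (2040 + 10) ctab :=
    h2040.extend fun m hm hmk ↦ colValid_of_checkTableCol (prm := prm) (by norm_num [prm]) a_pos consts_valid tC2040 hm hmk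
  have h2051 : TabColValid (2 ^ 320) a ks 320 (2050 + 1) ctab :=
    h2050.extend fun m hm hmk ↦ colValid_of_checkTableCol (prm := prm) (by norm_num [prm]) a_pos consts_valid tC2050 hm hmk
  exact h2051

end Summit.RiemannHypothesis.RiemannHypothesis.Theorems.WeilFormatCData.O106

-- ===== from WeilFormatCDataO106Front =====
namespace Summit.RiemannHypothesis.RiemannHypothesis.Theorems.WeilFormatCData.O106
open Literature.NumberTheory.LFunctions Literature.NumberTheory.LFunctions.Yoshida1992 Encl Literature.Analysis.ValidatedNumerics.NumericsMP

/-- odd column range (kit form). -/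
theorem ctab_valid_odd : TabColValid (2 ^ 320) O106.a O106.ks 320 (2048 + 2) O106.ctab :=
  fun m hm hmk ↦ ctab_valid m (by omega) (by omega)

/-- odd column range (column-data form). -/
theorem ctab_valid_oddK : TabColValid (2 ^ 320) O106.a O106.ks 320 (320 + 320 + 1) O106.ctab :=
  fun m hm hmk ↦ ctab_valid m (by omega) (by omega)

/-- the front-door constants are valid for `a`. -/
theorem fd_valid : FDValid (2 ^ 320) O106.a O106.F :=
  fdValid_of_check (prm := prm) (ks := ks) (by norm_num [prm]) primeData consts_valid tF

/-- `FA` is valid with the certified prime constant `A = 2358/1000` plus the margin μ = 2^-103. -/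
theorem fdA_valid : FDValidA (2 ^ 320) O106.a (((2989120115338164928729226158276733 : ℤ) : ℝ) / (1267650600228229401496703205376000 : ℕ)) O106.FA :=
  fd_valid.withFrac 2989120115338164928729226158276733 (by norm_num)

/-- λ-run: `FA` is valid with `A + 2·lam`, `lam = lamZ·2^-310`, `lamZ = 102844034832575377634685573909834406561420991602098741459288064` (the shape the odd λ-door reads). -/
theorem fdA_valid_shift : FDValidA (2 ^ 320) O106.a (((2358 : ℤ) : ℝ) / (1000 : ℕ) + 2 * ((((2 ^ 206 : ℤ) : ℤ) : ℝ) * (1 / 2 ^ 310))) O106.FA := by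
  convert fdA_valid using 2
  push_cast
  norm_num

/-- kernel (assembled from the eight bands of 216, `WeilFormatCData.A1.wvBands_range_of_bands4`): odd reciprocal column weights against
the arctan far diagonal, all 1728 columns, square-root minorants `O106CBOdd.rsW / 1099512676352`, weights unpacked once (`vw_eq_vwL`). -/
theorem tWvO : checkWeightsOddV (2 ^ 320) 190 O106.C O106.FA O106.ctab 320 1728 64 O106CBOdd.vw O106CBOdd.rsW 1099512676352 165796 1048576 = true := by
  rw [show checkWeightsOddV (2 ^ 320) 190 O106.C O106.FA O106.ctab 320 1728 64 O106CBOdd.vw O106CBOdd.rsW 1099512676352 165796 1048576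
      = (List.range 1728).all (fun t ↦ decide (0 < O106CBOdd.vw.getD t 0) && checkSqrtLower 320 (320 + t + 1) (O106CBOdd.rsW.getD t 0) 1099512676352 && match devOddABox (2 ^ 320) 190 O106.C O106.FA (tget O106.ctab (320 + t + 1)) (320 + t) 320 (O106CBOdd.rsW.getD t 0) 1099512676352 165796 1048576 with | some Y => decide ((2 ^ 64 : ℤ) * ((2 ^ 320 : ℕ) : ℤ) ≤ (O106CBOdd.vw.getD t 0 : ℤ) * Y.lo) | none => false) from rfl, vw_eq_vwL]
  exact WeilFormatCData.A1.wvBands_range_of_bands4 (a := 432) (b := 432) (c := 432) (d := 432)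
    (S2FormatC.E0.band_append (n₀ := 0) (k := 216) (k' := 216) tWvOb0 tWvOb216)
    (S2FormatC.E0.band_append (n₀ := 432) (k := 216) (k' := 216) tWvOb432 tWvOb648)
    (S2FormatC.E0.band_append (n₀ := 864) (k := 216) (k' := 216) tWvOb864 tWvOb1080)
    (S2FormatC.E0.band_append (n₀ := 1296) (k := 216) (k' := 216) tWvOb1296 tWvOb1512)

/-- the mean-square tail's sine hypotheses for `s = sFun sd1 csd`, `sFun2 sdm csd`, `sFun2 sdp csd` (window written out once). -/
theorem sines :
    (∀ k ∈ weilPrimeIndex O106.a, IsPrimePow k → 0 ≤ sFun O106.sd1 O106.csd k ∧ sFun O106.sd1 O106.csd k ≤ |Real.sin (Real.pi * Real.log k / (((53 : ℤ) : ℝ) / (50 : ℕ)) / 2)|) ∧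
    (∀ k ∈ weilPrimeIndex O106.a, ∀ k' ∈ weilPrimeIndex O106.a, IsPrimePow k → IsPrimePow k' → k ≠ k' →
      0 ≤ sFun2 O106.sdm O106.csd k k' ∧ sFun2 O106.sdm O106.csd k k' ≤ |Real.sin ((Real.pi * Real.log k / O106.a - Real.pi * Real.log k' / O106.a) / 2)|) ∧
    (∀ k ∈ weilPrimeIndex O106.a, ∀ k' ∈ weilPrimeIndex O106.a, IsPrimePow k → IsPrimePow k' →
      0 ≤ sFun2 O106.sdp O106.csd k k' ∧ sFun2 O106.sdp O106.csd k k' ≤ |Real.sin ((Real.pi * Real.log k / O106.a + Real.pi * Real.log k' / O106.a) / 2)|) :=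
  sines_of_check (prm := prm) (by norm_num [prm]) primeData consts_valid tSines

end Summit.RiemannHypothesis.RiemannHypothesis.Theorems.WeilFormatCData.O106

-- ===== from WeilFormatCDataO106Mid =====
namespace Summit.RiemannHypothesis.RiemannHypothesis.Theorems.WeilFormatCData.O106
open Literature.NumberTheory.LFunctions Literature.NumberTheory.LFunctions.Yoshida1992 Encl Literature.Analysis.ValidatedNumerics.NumericsMP

/-- the odd middle moment record is valid (light table on the middle range; `B₄` as a literal). -/
theorem momO_valid : MidMomValidO (2 ^ 320) O106.a (wvF (O106CBOdd.vw.drop 320) 64 640) 640 2048 4 O106.momO := by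
  have h : MidMomValidO (2 ^ 320) a (wvF (O106CBOdd.vw.drop 320) 64 640) 640 (640 + 1408) 4 (midMomO (2 ^ 320) C ctab 64 (O106CBOdd.vw.drop 320) 640 1408 4) :=
    midMomO_valid (S := 2 ^ 320) (by norm_num) primeData consts_valid (fun m hm hmk ↦ ctab_valid m (by omega) (by omega)) 4
  rw [show (640 + 1408 : ℕ) = 2048 from rfl] at h
  -- B g21: blocks AA/AB/BA entrywise (per-entry kernel facts `tMomO_<blk>_j_k`; one whole block exceeds the kernel memory ceiling at 1536 middle columns)
  refine ⟨fun j hj j' hj' ↦ ?_, fun j hj r hr ↦ ?_, fun r hr j hj ↦ ?_, fun r hr r' hr' ↦ by rw [tMomO_BB]; exact h.BB r hr r' hr', by rw [tMomO_sm]; exact h.sm⟩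
  · interval_cases j <;> interval_cases j' <;> simp only [tMomO_AA_0_0, tMomO_AA_0_1, tMomO_AA_0_2, tMomO_AA_0_3, tMomO_AA_1_0, tMomO_AA_1_1, tMomO_AA_1_2, tMomO_AA_1_3, tMomO_AA_2_0, tMomO_AA_2_1, tMomO_AA_2_2, tMomO_AA_2_3, tMomO_AA_3_0, tMomO_AA_3_1, tMomO_AA_3_2, tMomO_AA_3_3] <;> exact h.AA _ (by norm_num) _ (by norm_num)
  · interval_cases j <;> interval_cases r <;> simp only [tMomO_AB_0_0, tMomO_AB_0_1, tMomO_AB_0_2, tMomO_AB_0_3, tMomO_AB_1_0, tMomO_AB_1_1, tMomO_AB_1_2, tMomO_AB_1_3, tMomO_AB_2_0, tMomO_AB_2_1, tMomO_AB_2_2, tMomO_AB_2_3, tMomO_AB_3_0, tMomO_AB_3_1, tMomO_AB_3_2, tMomO_AB_3_3] <;> exact h.AB _ (by norm_num) _ (by norm_num)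
  · interval_cases r <;> interval_cases j <;> simp only [tMomO_BA_0_0, tMomO_BA_0_1, tMomO_BA_0_2, tMomO_BA_0_3, tMomO_BA_1_0, tMomO_BA_1_1, tMomO_BA_1_2, tMomO_BA_1_3, tMomO_BA_2_0, tMomO_BA_2_1, tMomO_BA_2_2, tMomO_BA_2_3, tMomO_BA_3_0, tMomO_BA_3_1, tMomO_BA_3_2, tMomO_BA_3_3] <;> exact h.BA _ (by norm_num) _ (by norm_num)

end Summit.RiemannHypothesis.RiemannHypothesis.Theorems.WeilFormatCData.O106

-- ===== from WeilFormatCDataO106CBOddCols0 =====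
namespace Summit.RiemannHypothesis.RiemannHypothesis.Theorems.WeilFormatCData.O106CBOdd
open Literature.NumberTheory.LFunctions Literature.NumberTheory.LFunctions.Yoshida1992 Encl Literature.Analysis.ValidatedNumerics.NumericsMP
open Summit.RiemannHypothesis.RiemannHypothesis.Theorems.WeilFormatCData.O106

/-- column data certified below row `12`. -/
theorem colData12 : DataNear (fun i t ↦ sectorKernel true (gramCoeff O106.a) i (320 + t)) 12 320 157 (2 ^ (157 - 1)) 154 O106CBOdd.ρc O106CBOdd.XP := by
  have hT := tab_valid_odd
  have hCT := ctab_valid_oddK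
  have h0 : DataNear (fun i t ↦ sectorKernel true (gramCoeff a) i (320 + t)) 0 320 157 (2 ^ (157 - 1)) 154 ρc XP := DataNear.zeroRows
  have h2 : DataNear (fun i t ↦ sectorKernel true (gramCoeff a) i (320 + t)) (0 + 2) 320 157 (2 ^ (157 - 1)) 154 ρc XP :=
    colDataNear_extendRows (S := 2 ^ 320) (by norm_num) a_pos primeData consts_valid (by norm_num : 1 ≤ 320) hT hCT true (by norm_num) rfl h0 tCol0
  have h4 : DataNear (fun i t ↦ sectorKernel true (gramCoeff a) i (320 + t)) (2 + 2) 320 157 (2 ^ (157 - 1)) 154 ρc XP :=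
    colDataNear_extendRows (S := 2 ^ 320) (by norm_num) a_pos primeData consts_valid (by norm_num : 1 ≤ 320) hT hCT true (by norm_num) rfl h2 tCol2
  have h6 : DataNear (fun i t ↦ sectorKernel true (gramCoeff a) i (320 + t)) (4 + 2) 320 157 (2 ^ (157 - 1)) 154 ρc XP :=
    colDataNear_extendRows (S := 2 ^ 320) (by norm_num) a_pos primeData consts_valid (by norm_num : 1 ≤ 320) hT hCT true (by norm_num) rfl h4 tCol4
  have h8 : DataNear (fun i t ↦ sectorKernel true (gramCoeff a) i (320 + t)) (6 + 2) 320 157 (2 ^ (157 - 1)) 154 ρc XP :=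
    colDataNear_extendRows (S := 2 ^ 320) (by norm_num) a_pos primeData consts_valid (by norm_num : 1 ≤ 320) hT hCT true (by norm_num) rfl h6 tCol6
  have h10 : DataNear (fun i t ↦ sectorKernel true (gramCoeff a) i (320 + t)) (8 + 2) 320 157 (2 ^ (157 - 1)) 154 ρc XP :=
    colDataNear_extendRows (S := 2 ^ 320) (by norm_num) a_pos primeData consts_valid (by norm_num : 1 ≤ 320) hT hCT true (by norm_num) rfl h8 tCol8
  have h12 : DataNear (fun i t ↦ sectorKernel true (gramCoeff a) i (320 + t)) (10 + 2) 320 157 (2 ^ (157 - 1)) 154 ρc XP :=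
    colDataNear_extendRows (S := 2 ^ 320) (by norm_num) a_pos primeData consts_valid (by norm_num : 1 ≤ 320) hT hCT true (by norm_num) rfl h10 tCol10
  exact h12

end Summit.RiemannHypothesis.RiemannHypothesis.Theorems.WeilFormatCData.O106CBOdd

-- ===== from WeilFormatCDataO106CBOddCols1 =====
namespace Summit.RiemannHypothesis.RiemannHypothesis.Theorems.WeilFormatCData.O106CBOdd
open Literature.NumberTheory.LFunctions Literature.NumberTheory.LFunctions.Yoshida1992 Encl Literature.Analysis.ValidatedNumerics.NumericsMP
open Summit.RiemannHypothesis.RiemannHypothesis.Theorems.WeilFormatCData.O106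

/-- column data certified below row `24`. -/
theorem colData24 : DataNear (fun i t ↦ sectorKernel true (gramCoeff O106.a) i (320 + t)) 24 320 157 (2 ^ (157 - 1)) 154 O106CBOdd.ρc O106CBOdd.XP := by
  have hT := tab_valid_odd
  have hCT := ctab_valid_oddK
  have h12 := colData12
  have h14 : DataNear (fun i t ↦ sectorKernel true (gramCoeff a) i (320 + t)) (12 + 2) 320 157 (2 ^ (157 - 1)) 154 ρc XP :=
    colDataNear_extendRows (S := 2 ^ 320) (by norm_num) a_pos primeData consts_valid (by norm_num : 1 ≤ 320) hT hCT true (by norm_num) rfl h12 tCol12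
  have h16 : DataNear (fun i t ↦ sectorKernel true (gramCoeff a) i (320 + t)) (14 + 2) 320 157 (2 ^ (157 - 1)) 154 ρc XP :=
    colDataNear_extendRows (S := 2 ^ 320) (by norm_num) a_pos primeData consts_valid (by norm_num : 1 ≤ 320) hT hCT true (by norm_num) rfl h14 tCol14
  have h18 : DataNear (fun i t ↦ sectorKernel true (gramCoeff a) i (320 + t)) (16 + 2) 320 157 (2 ^ (157 - 1)) 154 ρc XP :=
    colDataNear_extendRows (S := 2 ^ 320) (by norm_num) a_pos primeData consts_valid (by norm_num : 1 ≤ 320) hT hCT true (by norm_num) rfl h16 tCol16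
  have h20 : DataNear (fun i t ↦ sectorKernel true (gramCoeff a) i (320 + t)) (18 + 2) 320 157 (2 ^ (157 - 1)) 154 ρc XP :=
    colDataNear_extendRows (S := 2 ^ 320) (by norm_num) a_pos primeData consts_valid (by norm_num : 1 ≤ 320) hT hCT true (by norm_num) rfl h18 tCol18
  have h22 : DataNear (fun i t ↦ sectorKernel true (gramCoeff a) i (320 + t)) (20 + 2) 320 157 (2 ^ (157 - 1)) 154 ρc XP :=
    colDataNear_extendRows (S := 2 ^ 320) (by norm_num) a_pos primeData consts_valid (by norm_num : 1 ≤ 320) hT hCT true (by norm_num) rfl h20 tCol20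
  have h24 : DataNear (fun i t ↦ sectorKernel true (gramCoeff a) i (320 + t)) (22 + 2) 320 157 (2 ^ (157 - 1)) 154 ρc XP :=
    colDataNear_extendRows (S := 2 ^ 320) (by norm_num) a_pos primeData consts_valid (by norm_num : 1 ≤ 320) hT hCT true (by norm_num) rfl h22 tCol22
  exact h24

end Summit.RiemannHypothesis.RiemannHypothesis.Theorems.WeilFormatCData.O106CBOdd
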